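import Summits.QuantumFields.QCD.Theorems.QuarksAsStableActionUnquenchedChessboardBoundStubAssemblyAux4
import Mathlib
import HarnessLib

/-!
# Assembly of the unquenched chessboard bound, part 5: the universal-pattern (large-field) bound
(stub `stub_assembly` of crux stmt-QuantumFields-9735, line Sketch; auxiliary file 5)

* A word none of whose letters is empty forces at least `#cells / 16` DISTINCT `δ`-bad plaquettes
  (every placed plaquette has its corners in the closed unit cube of its cell, so at most `16`
  cells place a given plaquette), hence `δ L⁴ ≤ 16 S_W` on its event;
* the elementary bound `Re ∫ 1_S W ≤ sup_S ‖W‖` for a probability measure;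
* for the signed `SU(3)` weight: `‖W(U)‖ ≤ K^{12 N_f L⁴} e^{-β s}` whenever `S_W(U) ≥ s`, `β ≥ 0`,
  masses in `[m_lo, m_hi]`, `K = |m_lo| + |m_hi| + 100`, given the crude determinant bound
  `|det D_AP[U,m]| ≤ (|m+4|+96)^{12L⁴}` (hypothesis).
All statements here are proved; no definitions are introduced.
-/

noncomputable section

open MeasureTheory Matrix Complex Finset
open Literature.MathematicalPhysics.QuantumFieldTheory Literature.MathematicalPhysics.QuantumLattice
open scoped ComplexConjugate BigOperators ComplexOrder

namespace Summit.QuantumFields.QCD.Theorems.UnquenchedChessboardBoundLine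

section Pattern

variable {L N : ℕ} [NeZero L]
variable {G : Type*} [Group G] [TopologicalSpace G] [IsTopologicalGroup G] [CompactSpace G]
  [MeasurableSpace G] [BorelSpace G]
variable (ρ : G →* Matrix (Fin N) (Fin N) ℂ) (δ : ℝ)
variable {κ : Type*} [DecidableEq κ] (pos : (Fin 4 → ZMod L) → κ → Plaquette 4 L)

omit [NeZero L] in
/-- Iterated images of a nonempty letter are nonempty. -/
theorem asm_iterate_image_nonempty (f : κ → κ) (n : ℕ) {a : Finset κ} (ha : a.Nonempty) :
    ((fun s : Finset κ => s.image f)^[n] a).Nonempty := by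
  induction n generalizing a with
  | zero => exact ha
  | succ n ih => rw [Function.iterate_succ_apply]; exact ih (ha.image f)

omit [NeZero L] in
/-- The letters of a universal pattern of a nonempty letter are nonempty. -/
theorem asm_pattern_nonempty (f₀ f₁ f₂ f₃ : κ → κ) {a : Finset κ} (ha : a.Nonempty) (n₀ n₁ n₂ n₃ : ℕ) :
    ((fun s : Finset κ => s.image f₀)^[n₀] ((fun s : Finset κ => s.image f₁)^[n₁]
      ((fun s : Finset κ => s.image f₂)^[n₂] ((fun s : Finset κ => s.image f₃)^[n₃] a)))).Nonempty :=
  asm_iterate_image_nonempty f₀ n₀ (asm_iterate_image_nonempty f₁ n₁ (asm_iterate_image_nonempty f₂ n₂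
    (asm_iterate_image_nonempty f₃ n₃ ha)))

/-- The number of cells of the four-torus of side `L`. -/
theorem asm_card_cells : Fintype.card (Fin 4 → ZMod L) = L ^ 4 := by
  rw [Fintype.card_fun, ZMod.card, Fintype.card_fin]

omit [TopologicalSpace G] [IsTopologicalGroup G] [CompactSpace G] [MeasurableSpace G] [BorelSpace G]
  [DecidableEq κ] in
/-- **A word with no empty letter forces at least `#cells / 16` distinct bad plaquettes** on its
event, for a placement with the cube property. -/
theorem asm_card_cells_le_badCount (hfib : ∀ x q k, (pos x q).1 k = x k ∨ (pos x q).1 k = x k + 1)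
    (w : (Fin 4 → ZMod L) → Finset κ) (hw : ∀ x, (w x).Nonempty) (U : GaugeConfig 4 L G)
    (hU : ∀ c, ∀ q ∈ w c, δ ≤ plaquetteDeficit ρ U (pos c q)) :
    Fintype.card (Fin 4 → ZMod L) ≤ 16 * badCount ρ δ U := by
  classical
  have hQm : ∀ x, (hw x).choose ∈ w x := fun x => (hw x).choose_spec
  set f : (Fin 4 → ZMod L) → Plaquette 4 L := fun x => pos x (hw x).choose with hf
  have h1 : (Finset.univ : Finset (Fin 4 → ZMod L)).card ≤ 16 * (Finset.univ.image f).card := by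
    refine Finset.card_le_mul_card_image _ 16 fun y _ => ?_
    calc (Finset.univ.filter fun x => f x = y).card
        ≤ (Fintype.piFinset fun k : Fin 4 => ({y.1 k, y.1 k - 1} : Finset (ZMod L))).card := by
          refine Finset.card_le_card fun x hx => ?_
          rw [Finset.mem_filter] at hx
          rw [Fintype.mem_piFinset]
          intro k
          rw [Finset.mem_insert, Finset.mem_singleton, ← hx.2]
          rcases hfib x (hw x).choose k with h | h
          · left; rw [hf]; exact h.symm
          · right; rw [hf, h, add_sub_cancel_right]
      _ ≤ 16 := by
          rw [Fintype.card_piFinset]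
          calc ∏ k : Fin 4, ({y.1 k, y.1 k - 1} : Finset (ZMod L)).card ≤ ∏ _k : Fin 4, 2 :=
                Finset.prod_le_prod (fun k _ => Nat.zero_le _) fun k _ => Finset.card_le_two
            _ = 16 := by simp
  have h2 : (Finset.univ.image f).card ≤ badCount ρ δ U := by
    unfold badCount
    refine Finset.card_le_card fun p hp => ?_
    rw [Finset.mem_image] at hp
    obtain ⟨x, -, rfl⟩ := hp
    rw [Finset.mem_filter]
    exact ⟨Finset.mem_univ _, hU x _ (hQm x)⟩
  rw [← Finset.card_univ]
  exact h1.trans (Nat.mul_le_mul_left 16 h2)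

omit [TopologicalSpace G] [IsTopologicalGroup G] [CompactSpace G] [MeasurableSpace G] [BorelSpace G]
  [DecidableEq κ] in
/-- **`δ L⁴ ≤ 16 S_W(U)` on the event of a word with no empty letter** (unitary `ρ`, `δ ≥ 0`). -/
theorem asm_mul_pow_le_wilsonAction (hρu : ∀ g, ρ g ∈ Matrix.unitaryGroup (Fin N) ℂ) (hδ : 0 ≤ δ)
    (hfib : ∀ x q k, (pos x q).1 k = x k ∨ (pos x q).1 k = x k + 1)
    (w : (Fin 4 → ZMod L) → Finset κ) (hw : ∀ x, (w x).Nonempty) (U : GaugeConfig 4 L G)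
    (hU : ∀ c, ∀ q ∈ w c, δ ≤ plaquetteDeficit ρ U (pos c q)) :
    δ * (L : ℝ) ^ 4 ≤ 16 * wilsonAction ρ U := by
  have h1 : ((L : ℝ) ^ 4) ≤ 16 * (badCount ρ δ U : ℝ) := by
    have := asm_card_cells_le_badCount ρ δ pos hfib w hw U hU
    rw [asm_card_cells] at this
    exact_mod_cast this
  have h2 : δ * (badCount ρ δ U : ℝ) ≤ wilsonAction ρ U := by
    refine (mul_badCount_le ρ δ U).trans ?_
    rw [← goodAction_add_sum_bad ρ δ U]
    have h0 : 0 ≤ goodAction ρ δ U :=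
      Finset.sum_nonneg fun p _ => plaquetteDeficit_nonneg ρ hρu U p
    linarith
  nlinarith

/-- **`Re ∫ 1_S · W ≤ E`** for a probability measure when `‖W‖ ≤ E` on `S` and `E ≥ 0`. -/
theorem asm_re_integral_indicator_mul_le {X : Type*} [MeasurableSpace X] (μ : Measure X)
    [IsProbabilityMeasure μ] (S : Set X) (W : X → ℂ) {E : ℝ} (hE : 0 ≤ E)
    (hW : ∀ x ∈ S, ‖W x‖ ≤ E) : (∫ x, S.indicator 1 x * W x ∂μ).re ≤ E := by
  refine (Complex.re_le_norm _).trans ?_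
  have h := norm_integral_le_of_norm_le_const (μ := μ) (f := fun x => S.indicator (1 : X → ℂ) x * W x)
    (C := E) (ae_of_all _ fun x => ?_)
  · rwa [probReal_univ, mul_one] at h
  · by_cases hx : x ∈ S
    · rw [Set.indicator_of_mem hx, Pi.one_apply, one_mul]; exact hW x hx
    · rw [Set.indicator_of_notMem hx, zero_mul, norm_zero]; exact hE

end Pattern

/-! ## The signed `SU(3)` weight on large-field events -/

section SU3Weight

variable {L : ℕ} [NeZero L]

omit [NeZero L] in
/-- Masses in the window `[m_lo, m_hi]` have `|m + 4| + 96 ≤ |m_lo| + |m_hi| + 100`. -/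
theorem asm_abs_add_four_le {mlo mhi m : ℝ} (hm : mlo ≤ m ∧ m ≤ mhi) :
    |m + 4| + 96 ≤ |mlo| + |mhi| + 100 := by
  have h1 : |m + 4| ≤ |m| + 4 := by
    calc |m + 4| ≤ |m| + |4| := abs_add_le _ _
      _ = |m| + 4 := by norm_num
  have h2 : |m| ≤ |mlo| + |mhi| := by
    rw [abs_le]
    constructor
    · linarith [neg_abs_le mlo, abs_nonneg mhi]
    · linarith [le_abs_self mhi, abs_nonneg mlo]
  linarith

end SU3Weight

section MainWeight

/-- **The signed weight on a large-field event**: if `|det D_AP[U,m]| ≤ (|m+4|+96)^{12L⁴}` for all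
fields and masses, then for `β ≥ 0`, masses in `[m_lo, m_hi]` and `S_W(U) ≥ s`,
`‖∏_f det D_AP[U,m_f] e^{-βS_W(U)}‖ ≤ (K^{12 N_f})^{L⁴} e^{-β s}`, `K = |m_lo| + |m_hi| + 100`. -/
theorem asm_norm_signedWeight_le_of_action_ge {L : ℕ} [NeZero L]
    (hdet : ∀ (U : GaugeConfig 4 L (Matrix.specialUnitaryGroup (Fin 3) ℂ)) (m : ℝ),
      ‖(wilsonDiracAP U m).det‖ ≤ (|m + 4| + 96) ^ (12 * L ^ 4))
    {β : ℝ} (hβ : 0 ≤ β) {Nf : ℕ} {mlo mhi : ℝ} (m : Fin Nf → ℝ) (hm : ∀ f, mlo ≤ m f ∧ m f ≤ mhi)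
    {s : ℝ} (U : GaugeConfig 4 L (Matrix.specialUnitaryGroup (Fin 3) ℂ))
    (hs : s ≤ wilsonAction (fundamentalRep (Fin 3)) U) :
    ‖(∏ f, (wilsonDiracAP U (m f)).det) * (Real.exp (-β * wilsonAction (fundamentalRep (Fin 3)) U) : ℂ)‖ ≤
      ((|mlo| + |mhi| + 100) ^ (12 * Nf)) ^ (L ^ 4) * Real.exp (-β * s) := by
  rw [asm_norm_signedWeight]
  have hK : 0 ≤ |mlo| + |mhi| + 100 := by positivity
  refine mul_le_mul ?_ (Real.exp_le_exp.2 (by nlinarith)) (Real.exp_pos _).le (by positivity)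
  calc ∏ f, ‖(wilsonDiracAP U (m f)).det‖
      ≤ ∏ _f : Fin Nf, (|mlo| + |mhi| + 100) ^ (12 * L ^ 4) :=
        Finset.prod_le_prod (fun f _ => norm_nonneg _) fun f _ =>
          (hdet U (m f)).trans (pow_le_pow_left₀ (by positivity) (asm_abs_add_four_le (hm f)) _)
    _ = ((|mlo| + |mhi| + 100) ^ (12 * Nf)) ^ (L ^ 4) := by
        rw [Finset.prod_const, Finset.card_univ, Fintype.card_fin, ← pow_mul, ← pow_mul]
        ring_nf

end MainWeight

end Summit.QuantumFields.QCD.Theorems.UnquenchedChessboardBoundLine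

end
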